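import Literature.Analysis.FluidPDE.TorusWordLeibniz
import HarnessLib

/-!
# Chain rule along words on the torus: uniform sup bounds for `∂^w (φ ∘ ρ)`

Analysis/FluidPDE support file (everything proved; no named facts), sequel of `TorusWordLeibniz`.
Coefficients of quasilinear systems are smooth functions `φ(ρ)` of the unknowns; their derivatives
along a word `w` are polynomials in the derivatives of `ρ` with coefficients `φ^{(k)}(ρ)` (Faà di
Bruno). For energy estimates of arbitrary order (Majda 1984, Ch. 2 §2.1, Prop. 2.1 and proof of
Thm 2.2) only BOUNDS are needed, and these follow by a simple recursion avoiding the combinatorics: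
`∂^{w' ++ [i]}(φ ∘ ρ) = ∂^{w'}((φ' ∘ ρ) · ∂ᵢρ) = ∑_{(α,β) ∈ splits w'} ∂^α(φ' ∘ ρ) · ∂^β ∂ᵢρ`
(`wordDeriv_comp_concat`). This file proves the resulting **uniform sup bound**

* `exists_wordDeriv_comp_bound` — for every order `n` and levels `Cφ, Cρ ≥ 0` there is `K` such
  that for ALL smooth `φ` on an open `V ⊇ range ρ` with `|φ^{(k)}| ≤ Cφ` on the range (`k ≤ n`,
  iterated `deriv`) and all smooth `ρ : 𝕋^d → ℝ` with `|∂^v ρ| ≤ Cρ` for `1 ≤ |v| ≤ n`: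
  `|∂^w (φ ∘ ρ)(x)| ≤ K` for `1 ≤ |w| ≤ n`

(induction on `n`, the induction hypothesis being applied to `φ'`), together with the list-sum
bookkeeping `abs_list_sum_apply_le`.

## References

* A. Majda, *Compressible Fluid Flow and Systems of Conservation Laws in Several Space
  Variables*, Springer 1984, Ch. 2 §2.1, Prop. 2.1. [`Majda1984`]
-/

noncomputable section

open Set Function
open scoped ContDiff

namespace Literature.Analysis.FluidPDE

namespace Torus

open FunctionSpaces FunctionSpaces.Torus

variable {d : Type*} [Fintype d] [DecidableEq d]

/-! ## Bookkeeping -/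

omit [Fintype d] [DecidableEq d] in
/-- `|∑_{p ∈ l} g_p(x)| ≤ |l| · B` when `|g_p(x)| ≤ B` for `p ∈ l`. [folklore] -/
theorem abs_list_sum_apply_le {ι : Type*} (l : List ι) {g : ι → UnitAddTorus d → ℝ} {x : UnitAddTorus d} {B : ℝ}
    (h : ∀ p ∈ l, |g p x| ≤ B) : |(l.map g).sum x| ≤ l.length * B := by
  induction l with
  | nil => simp
  | cons a l ih =>
      rw [List.map_cons, List.sum_cons, Pi.add_apply, List.length_cons, Nat.cast_succ, add_mul, one_mul]
      have h1 := h a (by simp)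
      have h2 := ih fun p hp => h p (List.mem_cons_of_mem a hp)
      exact (abs_add_le _ _).trans (by linarith)

/-- Iterated derivatives of a smooth function on an open set are smooth there. [folklore] -/
theorem contDiffOn_iterate_deriv {φ : ℝ → ℝ} {V : Set ℝ} (hφ : ContDiffOn ℝ ∞ φ V) (hV : IsOpen V) :
    ∀ k : ℕ, ContDiffOn ℝ ∞ (deriv^[k] φ) V
  | 0 => hφ
  | k + 1 => by
      rw [Function.iterate_succ']
      exact contDiffOn_deriv_of_isOpen (contDiffOn_iterate_deriv hφ hV k) hV

/-! ## The chain rule along words -/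

section Chain

variable {φ : ℝ → ℝ} {V : Set ℝ} {ρ : UnitAddTorus d → ℝ}

/-- `∂ᵢ(φ ∘ ρ) = (φ' ∘ ρ) · ∂ᵢρ` as functions. [folklore] -/
theorem partialDeriv_comp_fun' (hφ : ContDiffOn ℝ ∞ φ V) (hV : IsOpen V) (hρ : IsSmooth ρ) (hρV : ∀ x, ρ x ∈ V) (i : d) :
    Torus.partialDeriv i (fun y => φ (ρ y)) = fun x => deriv φ (ρ x) * Torus.partialDeriv i ρ x :=
  funext fun x => partialDeriv_comp_of_contDiffOn hφ hV hρ hρV i x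

/-- **Chain rule along a word with a distinguished innermost letter**:
`∂^{w ++ [i]}(φ ∘ ρ) = ∑_{(α,β) ∈ splits w} ∂^α(φ' ∘ ρ) · ∂^β ∂ᵢρ`. [folklore] -/
theorem wordDeriv_comp_concat (hφ : ContDiffOn ℝ ∞ φ V) (hV : IsOpen V) (hρ : IsSmooth ρ) (hρV : ∀ x, ρ x ∈ V)
    (w : List d) (i : d) :
    wordDeriv (w ++ [i]) (fun y => φ (ρ y)) =
      ((splits w).map fun p => fun x => wordDeriv p.1 (fun y => deriv φ (ρ y)) x *
        wordDeriv p.2 (Torus.partialDeriv i ρ) x).sum := by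
  rw [wordDeriv_concat, partialDeriv_comp_fun' hφ hV hρ hρV i]
  exact wordDeriv_mul (IsSmooth.comp_of_contDiffOn (contDiffOn_deriv_of_isOpen hφ hV) hρ hρV) (hρ.partialDeriv i) w

end Chain

/-- **Uniform sup bound for `∂^w(φ ∘ ρ)`, all orders.** For every `n` and `Cφ, Cρ ≥ 0` there is
`K ≥ 0` such that: for all smooth `φ` on an open `V` and smooth `ρ : 𝕋^d → ℝ` with range in `V`,
if `|φ^{(k)}(ρ(x))| ≤ Cφ` for `k ≤ n` (iterated `deriv`) and `|∂^v ρ(x)| ≤ Cρ` for all words with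
`1 ≤ |v| ≤ n`, then `|∂^w(φ ∘ ρ)(x)| ≤ K` for all words with `1 ≤ |w| ≤ n`.
[cite: Majda1984, Ch. 2 §2.1 Prop. 2.1] -/
theorem exists_wordDeriv_comp_bound (d : Type*) [Fintype d] [DecidableEq d] (n : ℕ) (Cφ Cρ : ℝ) :
    ∃ K : ℝ, 0 ≤ K ∧ ∀ (φ : ℝ → ℝ) (V : Set ℝ), IsOpen V → ContDiffOn ℝ ∞ φ V →
      ∀ (ρ : UnitAddTorus d → ℝ), IsSmooth ρ → (∀ x, ρ x ∈ V) →
      (∀ k ≤ n, ∀ x, |(deriv^[k] φ) (ρ x)| ≤ Cφ) →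
      (∀ v : List d, 1 ≤ v.length → v.length ≤ n → ∀ x, |wordDeriv v ρ x| ≤ Cρ) →
      ∀ w : List d, 1 ≤ w.length → w.length ≤ n → ∀ x, |wordDeriv w (fun y => φ (ρ y)) x| ≤ K := by
  induction n with
  | zero => exact ⟨0, le_rfl, fun φ V _ _ ρ _ _ _ _ w h1 h0 => by omega⟩
  | succ n ih =>
      obtain ⟨Kn, hKn0, hKn⟩ := ih
      -- the new constant
      refine ⟨2 ^ n * (max (|Cφ|) Kn * |Cρ|), by positivity, ?_⟩
      intro φ V hV hφ ρ hρ hρV hCφ hCρ w hw1 hwn x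
      -- split off the innermost letter
      obtain ⟨w', i, rfl⟩ : ∃ w' i, w = w' ++ [i] := by
        rcases List.eq_nil_or_concat w with h | ⟨L, b, h⟩
        · subst h; simp at hw1
        · exact ⟨L, b, by rw [h, List.concat_eq_append]⟩
      have hlen : w'.length ≤ n := by rw [List.length_append, List.length_singleton] at hwn; omega
      rw [wordDeriv_comp_concat hφ hV hρ hρV w' i]
      -- the factors: `∂^α(φ' ∘ ρ)` by the induction hypothesis (applied to `φ'`), `∂^β∂ᵢρ = ∂^{β ++ [i]}ρ`
      have hφ' : ContDiffOn ℝ ∞ (deriv φ) V := contDiffOn_deriv_of_isOpen hφ hV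
      have hCφ' : ∀ k ≤ n, ∀ x, |(deriv^[k] (deriv φ)) (ρ x)| ≤ Cφ := fun k hk x => by
        have := hCφ (k + 1) (by omega) x
        rwa [Function.iterate_succ_apply] at this
      have hCρ' : ∀ v : List d, 1 ≤ v.length → v.length ≤ n → ∀ x, |wordDeriv v ρ x| ≤ Cρ := fun v h1 h2 x =>
        hCρ v h1 (by omega) x
      have hA : ∀ p ∈ splits w', |wordDeriv p.1 (fun y => deriv φ (ρ y)) x| ≤ max (|Cφ|) Kn := by
        intro p hp
        have hl := (mem_splits_length_le hp).1
        by_cases h0 : p.1 = []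
        · rw [h0, wordDeriv_nil]
          have := hCφ 1 (by omega) x
          simp only [Function.iterate_one] at this
          exact (this.trans (le_abs_self _)).trans (le_max_left _ _)
        · have h1 : 1 ≤ p.1.length := List.length_pos_iff.2 h0
          exact (hKn (deriv φ) V hV hφ' ρ hρ hρV hCφ' hCρ' p.1 h1 (hl.trans hlen) x).trans (le_max_right _ _)
      have hB : ∀ p ∈ splits w', |wordDeriv p.2 (Torus.partialDeriv i ρ) x| ≤ |Cρ| := by
        intro p hp
        have hl := (mem_splits_length_le hp).2
        rw [← wordDeriv_concat]
        refine (hCρ (p.2 ++ [i]) (by simp) ?_ x).trans (le_abs_self _)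
        rw [List.length_append, List.length_singleton]; omega
      have hterm : ∀ p ∈ splits w', |(fun x => wordDeriv p.1 (fun y => deriv φ (ρ y)) x *
          wordDeriv p.2 (Torus.partialDeriv i ρ) x) x| ≤ max (|Cφ|) Kn * |Cρ| := fun p hp => by
        simp only [abs_mul]
        exact mul_le_mul (hA p hp) (hB p hp) (abs_nonneg _) (le_trans (abs_nonneg _) (le_max_left _ _))
      refine (abs_list_sum_apply_le (splits w') hterm).trans ?_
      rw [length_splits]
      have h2 : ((2 : ℕ) ^ w'.length : ℝ) ≤ 2 ^ n := by exact_mod_cast Nat.pow_le_pow_right (by norm_num) hlen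
      have hM : 0 ≤ max (|Cφ|) Kn * |Cρ| := by positivity
      push_cast
      exact mul_le_mul_of_nonneg_right h2 hM


/-! ## Products along words: uniform sup bound -/

/-- **Uniform sup bound for `∂^w(f g)`**: if `|∂^v f| ≤ Cf` and `|∂^v g| ≤ Cg` for ALL words
`|v| ≤ n` (including the empty word), then `|∂^w(fg)| ≤ 2^{|w|} Cf Cg` for `|w| ≤ n`. [folklore] -/
theorem abs_wordDeriv_mul_le {f g : UnitAddTorus d → ℝ} (hf : IsSmooth f) (hg : IsSmooth g) {n : ℕ} {Cf Cg : ℝ}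
    (hCf : ∀ v : List d, v.length ≤ n → ∀ x, |wordDeriv v f x| ≤ Cf)
    (hCg : ∀ v : List d, v.length ≤ n → ∀ x, |wordDeriv v g x| ≤ Cg)
    {w : List d} (hw : w.length ≤ n) (x : UnitAddTorus d) :
    |wordDeriv w (fun y => f y * g y) x| ≤ 2 ^ w.length * (Cf * Cg) := by
  rw [wordDeriv_mul hf hg w]
  have hCf0 : 0 ≤ Cf := (abs_nonneg _).trans (hCf [] (by simp) x)
  have hterm : ∀ p ∈ splits w, |(fun y => wordDeriv p.1 f y * wordDeriv p.2 g y) x| ≤ Cf * Cg := fun p hp => by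
    obtain ⟨h1, h2⟩ := mem_splits_length_le hp
    simp only [abs_mul]
    exact mul_le_mul (hCf p.1 (h1.trans hw) x) (hCg p.2 (h2.trans hw) x) (abs_nonneg _) hCf0
  refine (abs_list_sum_apply_le (splits w) hterm).trans (le_of_eq ?_)
  rw [length_splits]; push_cast; ring

end Torus

end Literature.Analysis.FluidPDE

end
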